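import Literature.NumberTheory.GaloisRepresentations.IdeleClassBarModPairingValues
import Literature.NumberTheory.GaloisRepresentations.IdeleClassCharacterPairing
import HarnessLib

/-!
# The layer pairing values of `(U_L, Res C̄)` ARE door-c6's `inv_{E/L}(ι[x] ∪ β_m[χ])` (Tate C–F VII §11.3): the
# vector `x_E` is an idèle class of `L`, the character lives on `Gal(E/L)` (Milne ADT I Thm. 1.8 (b), arithmetic side)

Topic `NumberTheory/GaloisRepresentations`; namespace `Literature.NumberTheory.GaloisRepresentations.IdeleClassBar`.
Sequel to door-c4 g16's `IdeleClassBarModPairingValues.lean` (`layerPairingValue_eq_classInvAll`: the layer pairing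
value at the trace layer of `E ⊇ L` is `classInvAll L E (H²(id, r ↦ r • x_E) (β_m (χ ∘ g)))`) and door-c6 g13/g14's
`IdeleClassCarryInvariant.lean` (`baseInvariant`, `baseInvariant_surjective`: `C_E^{Gal(E/L)} = ι(C_L)`),
`IdeleClassCharacterPairing.lean` (`baseCup x = ι[x] ∪ ·`), `IntModBockstein.lean` (`map_H1IsoOfIsTrivial_inv_comp`).
Definitions with bodies (`galTraceQuotEquiv`, `galCharacter`, `traceCharacter`) and theorems; NO named fact, no `sorry`, no
instance, no notation.

THE POINT.  In `layerPairingValue_eq_classInvAll` the vector `x_E = layerVector h φ ∈ C_E^{Gal(E/L)}` IS `ι[x]` for an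
idèle `x` of `L` (`exists_coe_baseInvariant_eq_layerVector`, door-c6 `baseInvariant_surjective`), and the pulled-back
class `H¹(g, 𝟙) χ` IS the class `[χ₀]` of the character `χ₀ = χ ∘ g : Gal(E/L) → ℤ/m` (`galCharacter`,
`map_galToTraceQuot_eq_H1IsoOfIsTrivial_inv`; every `χ₀` arises, `galCharacter_traceCharacter`).  Hence

  **`inv_U (Inf (H²(id, φ_V) (β_m χ))) = classInvAll L E (baseCup x (β_m [χ₀]))`** (`layerPairingValue_eq_classInvAll_baseCup`)

— verbatim the left-hand side of door-c6 g14's `classInvAll_baseCup_bockstein_*` / `IdeleClassAlphaOneLayers` for the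
base field `L` (whose values are `−χ₀(ψ_{E/L} x)/m`).  The sequel runs Milne's (b) for `(U_L, Res C̄)` on these.

HONEST FRAMING: bookkeeping; no case of BSD or of Poitou–Tate is proved.  Route A (A5)-ARITH of crux
`AnticycControlAdditiveK` (item 19295, cell bsd-schneider), seat door-c4 gen 16.

## References
* J. W. S. Cassels, A. Fröhlich (eds.), *Algebraic Number Theory* (1967), Ch. VII (J. Tate) §8 Prop. 8.1, §11.3.
  [CasselsFrohlichANT1967]
* J. S. Milne, *Arithmetic Duality Theorems* (2nd ed. 2006), I §1 Lemma 1.7, Theorem 1.8 (b). [MilneADT2006]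
* K. S. Brown, *Cohomology of Groups* (1982), III §8 (functoriality of `H¹`). [Brown1982CohomologyGroups]
-/

noncomputable section

-- as in door-c6's `IdeleClassCharacterPairing*`: the Bockstein classes are compared across the definitionally equal
-- objects `(intModShortComplex G m).X₃ = Rep.trivial ℤ G (ℤ/m)` / `X₁ = Rep.trivial ℤ G ℤ`
set_option backward.isDefEq.respectTransparency false

open NumberField CategoryTheory groupCohomology
open Field (absoluteGaloisGroup)
open Literature.NumberTheory.Automorphic Literature.NumberTheory.Automorphic.IdeleClassGroup
open Literature.NumberTheory.NumberFields
open Literature.Algebra.Homology Literature.Algebra.Homology.DiscreteRep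
open scoped Classical

namespace Literature.NumberTheory.GaloisRepresentations

namespace IdeleClassBar

variable {F : Type} [Field F] [NumberField F] {L E : GalLayer F}

/-! ## §26. `g : Gal(E/L) ≃* U_L ⧸ (U_E ∩ U_L)` as an isomorphism; the characters `χ ∘ g` of `Gal(E/L)` -/

omit [NumberField F] in
/-- **`g : Gal(E/L) ≃* U_L ⧸ (U_E ∩ U_L)`** (`galEquivSubgroupImage` then the inverse of door-c6's `subgroupImageEquiv`);
its underlying homomorphism is `galToTraceQuot`. [cite: Serre1979, XI §1 (iv)] -/
def galTraceQuotEquiv (h : L ≤ E) :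
    (letI := GalLayer.algebraOfLE h; (E.1 ≃ₐ[L.1] E.1)) ≃*
      (L.openNormalSubgroup : Subgroup (absoluteGaloisGroup F)) ⧸
        (traceOpenNormalSubgroup (L.openNormalSubgroup : Subgroup (absoluteGaloisGroup F)) E.openNormalSubgroup :
          Subgroup (L.openNormalSubgroup : Subgroup (absoluteGaloisGroup F))) :=
  (galEquivSubgroupImage h).trans (GalLayer.subgroupImageEquiv (L.openNormalSubgroup : Subgroup (absoluteGaloisGroup F)) E).symm

omit [NumberField F] in
/-- `galTraceQuotEquiv` is `galToTraceQuot` on elements. [cite: Serre1979, XI §1 (iv)] -/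
@[simp]
theorem galTraceQuotEquiv_apply (h : L ≤ E) (σ : letI := GalLayer.algebraOfLE h; (E.1 ≃ₐ[L.1] E.1)) :
    galTraceQuotEquiv h σ = galToTraceQuot h σ := rfl

/-- **The character `χ₀ = [χ] ∘ g : Gal(E/L) → ℤ/m`** of a class `χ ∈ H¹(U_L ⧸ (U_E ∩ U_L), ℤ/m)` (Mathlib
`H1IsoOfIsTrivial`, then pull back along `g`). [cite: Brown1982CohomologyGroups, III §8] -/
def galCharacter (h : L ≤ E) {m : ℕ}
    (χ : groupCohomology (Rep.trivial ℤ ((L.openNormalSubgroup : Subgroup (absoluteGaloisGroup F)) ⧸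
        (traceOpenNormalSubgroup (L.openNormalSubgroup : Subgroup (absoluteGaloisGroup F)) E.openNormalSubgroup :
          Subgroup (L.openNormalSubgroup : Subgroup (absoluteGaloisGroup F)))) (ZMod m)) 1) :
    Additive (letI := GalLayer.algebraOfLE h; (E.1 ≃ₐ[L.1] E.1)) →+ ZMod m :=
  ((H1IsoOfIsTrivial (Rep.trivial ℤ _ (ZMod m))).hom χ :
      Additive ((L.openNormalSubgroup : Subgroup (absoluteGaloisGroup F)) ⧸
        (traceOpenNormalSubgroup (L.openNormalSubgroup : Subgroup (absoluteGaloisGroup F)) E.openNormalSubgroup :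
          Subgroup (L.openNormalSubgroup : Subgroup (absoluteGaloisGroup F)))) →+ ZMod m).comp
    (MonoidHom.toAdditive (galToTraceQuot h))

/-- **The class `χ = [χ₀ ∘ g⁻¹] ∈ H¹(U_L ⧸ (U_E ∩ U_L), ℤ/m)` of a character `χ₀ : Gal(E/L) → ℤ/m`** (inverse to
`galCharacter`). [cite: Brown1982CohomologyGroups, III §8] -/
def traceCharacter (h : L ≤ E) {m : ℕ} (χ₀ : Additive (letI := GalLayer.algebraOfLE h; (E.1 ≃ₐ[L.1] E.1)) →+ ZMod m) :
    groupCohomology (Rep.trivial ℤ ((L.openNormalSubgroup : Subgroup (absoluteGaloisGroup F)) ⧸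
        (traceOpenNormalSubgroup (L.openNormalSubgroup : Subgroup (absoluteGaloisGroup F)) E.openNormalSubgroup :
          Subgroup (L.openNormalSubgroup : Subgroup (absoluteGaloisGroup F)))) (ZMod m)) 1 :=
  (H1IsoOfIsTrivial (Rep.trivial ℤ _ (ZMod m))).inv (χ₀.comp (MonoidHom.toAdditive (galTraceQuotEquiv h).symm.toMonoidHom))

omit [NumberField F] in
/-- `galCharacter (traceCharacter χ₀) = χ₀`: every character of `Gal(E/L)` is a `χ ∘ g`. [cite: Brown1982CohomologyGroups, III §8] -/
theorem galCharacter_traceCharacter (h : L ≤ E) {m : ℕ}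
    (χ₀ : Additive (letI := GalLayer.algebraOfLE h; (E.1 ≃ₐ[L.1] E.1)) →+ ZMod m) :
    galCharacter h (traceCharacter h χ₀) = χ₀ := by
  rw [galCharacter, traceCharacter, Iso.inv_hom_id_apply]
  refine AddMonoidHom.ext fun σ => ?_
  change χ₀ (Additive.ofMul ((galTraceQuotEquiv h).symm (galToTraceQuot h (Additive.toMul σ)))) = χ₀ σ
  rw [← galTraceQuotEquiv_apply, MulEquiv.symm_apply_apply]
  rfl

omit [NumberField F] in
/-- **`H¹(g, 𝟙) χ = [χ ∘ g]`**: the pull-back of `χ` to `Gal(E/L)` is the class of `galCharacter h χ` (door-c6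
`Bockstein.map_H1IsoOfIsTrivial_inv_comp`). [cite: Brown1982CohomologyGroups, III §8] -/
theorem map_galToTraceQuot_eq_H1IsoOfIsTrivial_inv (h : L ≤ E) {m : ℕ}
    (χ : groupCohomology (Rep.trivial ℤ ((L.openNormalSubgroup : Subgroup (absoluteGaloisGroup F)) ⧸
        (traceOpenNormalSubgroup (L.openNormalSubgroup : Subgroup (absoluteGaloisGroup F)) E.openNormalSubgroup :
          Subgroup (L.openNormalSubgroup : Subgroup (absoluteGaloisGroup F)))) (ZMod m)) 1) :
    (groupCohomology.map (galToTraceQuot h) (𝟙 (Rep.trivial ℤ _ (ZMod m))) 1 χ :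
        groupCohomology (Bockstein.intModShortComplex (letI := GalLayer.algebraOfLE h; (E.1 ≃ₐ[L.1] E.1)) m).X₃ 1) =
      (H1IsoOfIsTrivial (Rep.trivial ℤ (letI := GalLayer.algebraOfLE h; (E.1 ≃ₐ[L.1] E.1)) (ZMod m))).inv
        (galCharacter h χ) := by
  have key := Bockstein.map_H1IsoOfIsTrivial_inv_comp (galToTraceQuot h)
    ((H1IsoOfIsTrivial (Rep.trivial ℤ _ (ZMod m))).hom χ :
      Additive ((L.openNormalSubgroup : Subgroup (absoluteGaloisGroup F)) ⧸
        (traceOpenNormalSubgroup (L.openNormalSubgroup : Subgroup (absoluteGaloisGroup F)) E.openNormalSubgroup :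
          Subgroup (L.openNormalSubgroup : Subgroup (absoluteGaloisGroup F)))) →+ ZMod m)
  rwa [Iso.hom_inv_id_apply] at key

/-! ## §27. `x_E = ι[x]` for an idèle `x` of `L` -/

/-- **`x_E = ι[x]` for some idèle `x` of `L`**: the `Gal(E/L)`-invariant vector `layerVector h φ ∈ C_E` is the class of
a base-changed idèle of `L` (door-c6 `baseInvariant_surjective`: `C_E^{Gal(E/L)} = ι(C_L)`, Tate VII §8 Prop. 8.1).
[cite: CasselsFrohlichANT1967, Ch. VII §8 Prop. 8.1] -/
theorem exists_coe_baseInvariant_eq_layerVector (h : L ≤ E)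
    (φ : triv (k := ℤ) (Γ := (L.openNormalSubgroup : Subgroup (absoluteGaloisGroup F))) ℤ ⟶
      (resD ℤ (L.openNormalSubgroup : Subgroup (absoluteGaloisGroup F))).obj (classData F).toSystem.toD) :
    letI := GalLayer.algebraOfLE h; haveI := GalLayer.isScalarTower_of_le h; haveI := L.numberField;
    haveI := E.numberField; haveI := E.isGalois; haveI : IsGalois L.1 E.1 := IsGalois.tower_top_of_isGalois F L.1 E.1;
    ∃ x : ideleGroup L.1,
      ((IdeleCohomology.baseInvariant (E := E.1) x : (IdeleClassGroup.galoisRep L.1 E.1).ρ.invariants) :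
        (IdeleClassGroup.galoisRep L.1 E.1).V) = layerVector h φ := by
  letI := GalLayer.algebraOfLE h
  haveI := GalLayer.isScalarTower_of_le h
  haveI := L.numberField
  haveI := E.numberField
  haveI := E.isGalois
  haveI : IsGalois L.1 E.1 := IsGalois.tower_top_of_isGalois F L.1 E.1
  obtain ⟨x, hx⟩ := IdeleCohomology.baseInvariant_surjective (F := L.1) (E := E.1)
    ⟨layerVector h φ, fun g => layerVector_invariant h φ g⟩
  exact ⟨x, congrArg Subtype.val hx⟩

/-- Congruence for door-c6's `smulHom` in its vector argument (the invariance proof is irrelevant).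
[cite: Neukirch2013, II §4] -/
private theorem smulHom_congr {G : Type} [Group G] [Fintype G] (A : Rep ℤ G) {v v' : A.V} (hv : v = v')
    (h : ∀ g, A.ρ g v = v) (h' : ∀ g, A.ρ g v' = v') : Unramified.smulHom A v h = Unramified.smulHom A v' h' := by
  subst hv
  rfl

/-! ## §28. The layer pairing value is door-c6's `inv_{E/L}(ι[x] ∪ β_m[χ₀])` -/

set_option maxHeartbeats 800000 in
-- one rewrite with §25's comparison inside the large unfolded layer terms
/-- **`inv_U (Inf (H²(id, φ_V) (β_m χ))) = inv_{E/L}(ι[x] ∪ β_m[χ₀])`**: for `U = U_L`, a layer `E ⊇ L`, `φ : ℤ → Res_U C̄`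
with `x_E = ι[x]` (`x` an idèle of `L`, §27) and `χ ∈ H¹(U_L ⧸ (U_E ∩ U_L), ℤ/m)` with character `χ₀ = χ ∘ g` of
`Gal(E/L)`, the layer pairing value of door-c4 g16 (written out, as in `layerPairingValue_eq_classInvAll`) is door-c6's
`classInvAll L E (baseCup x (β_m [χ₀]))` — the left-hand side of `classInvAll_baseCup_bockstein_*`
(`= −χ₀(ψ_{E/L} x)/m`). [cite: CasselsFrohlichANT1967, Ch. VII §11.3][cite: MilneADT2006, I Theorem 1.8 (b)] -/
theorem layerPairingValue_eq_classInvAll_baseCup (h : L ≤ E) {m : ℕ} (hm : 0 < m)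
    (φ : triv (k := ℤ) (Γ := (L.openNormalSubgroup : Subgroup (absoluteGaloisGroup F))) ℤ ⟶
      (resD ℤ (L.openNormalSubgroup : Subgroup (absoluteGaloisGroup F))).obj (classData F).toSystem.toD)
    (χ : groupCohomology (Rep.trivial ℤ ((L.openNormalSubgroup : Subgroup (absoluteGaloisGroup F)) ⧸
        (traceOpenNormalSubgroup (L.openNormalSubgroup : Subgroup (absoluteGaloisGroup F)) E.openNormalSubgroup :
          Subgroup (L.openNormalSubgroup : Subgroup (absoluteGaloisGroup F)))) (ZMod m)) 1)
    (x : letI := GalLayer.algebraOfLE h; haveI := L.numberField; ideleGroup L.1)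
    (hx : letI := GalLayer.algebraOfLE h; haveI := GalLayer.isScalarTower_of_le h; haveI := L.numberField;
      haveI := E.numberField; haveI := E.isGalois; haveI : IsGalois L.1 E.1 := IsGalois.tower_top_of_isGalois F L.1 E.1;
      ((IdeleCohomology.baseInvariant (E := E.1) x : (IdeleClassGroup.galoisRep L.1 E.1).ρ.invariants) :
        (IdeleClassGroup.galoisRep L.1 E.1).V) = layerVector h φ) :
    haveI : NeZero m := ⟨hm.ne'⟩
    classBarInvAt F (L.openNormalSubgroup : Subgroup (absoluteGaloisGroup F)) (LayerColimit.coe_isOpen _)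
        (LayerColimit.inflG
          (traceOpenNormalSubgroup (L.openNormalSubgroup : Subgroup (absoluteGaloisGroup F)) E.openNormalSubgroup)
          ((resD ℤ (L.openNormalSubgroup : Subgroup (absoluteGaloisGroup F))).obj (classData F).toSystem.toD) 2
          (groupCohomology.map (MonoidHom.id _)
            (LayerColimit.homToLayer
              (traceOpenNormalSubgroup (L.openNormalSubgroup : Subgroup (absoluteGaloisGroup F)) E.openNormalSubgroup :
                Subgroup (L.openNormalSubgroup : Subgroup (absoluteGaloisGroup F)))
              ((resD ℤ (L.openNormalSubgroup : Subgroup (absoluteGaloisGroup F))).obj (classData F).toSystem.toD) φ) 2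
            (groupCohomology.δ (Bockstein.intModShortComplex_shortExact
              ((L.openNormalSubgroup : Subgroup (absoluteGaloisGroup F)) ⧸
                (traceOpenNormalSubgroup (L.openNormalSubgroup : Subgroup (absoluteGaloisGroup F)) E.openNormalSubgroup :
                  Subgroup (L.openNormalSubgroup : Subgroup (absoluteGaloisGroup F)))) m) 1 2 rfl χ))) =
      (letI := GalLayer.algebraOfLE h; haveI := GalLayer.isScalarTower_of_le h; haveI := L.numberField;
        haveI := E.numberField; haveI := E.isGalois; haveI : IsGalois L.1 E.1 := IsGalois.tower_top_of_isGalois F L.1 E.1;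
        IdeleCohomology.classInvAll L.1 E.1
          (IdeleCohomology.baseCup (E := E.1) x
            (groupCohomology.δ (Bockstein.intModShortComplex_shortExact (E.1 ≃ₐ[L.1] E.1) m) 1 2 rfl
              ((H1IsoOfIsTrivial (Rep.trivial ℤ (E.1 ≃ₐ[L.1] E.1) (ZMod m))).inv (galCharacter h χ))))) := by
  haveI : NeZero m := ⟨hm.ne'⟩
  letI := GalLayer.algebraOfLE h
  haveI := GalLayer.isScalarTower_of_le h
  haveI := L.numberField
  haveI := E.numberField
  haveI := E.isGalois
  haveI : IsGalois L.1 E.1 := IsGalois.tower_top_of_isGalois F L.1 E.1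
  rw [layerPairingValue_eq_classInvAll h hm φ χ, map_galToTraceQuot_eq_H1IsoOfIsTrivial_inv h χ,
    smulHom_congr (IdeleClassGroup.galoisRep L.1 E.1) hx.symm (layerVector_invariant h φ)
      (fun g => (IdeleCohomology.baseInvariant (E := E.1) x).2 g)]
  rfl

/-- **Existential form**: the layer pairing value is `inv_{E/L}(ι[x] ∪ β_m[χ ∘ g])` for SOME idèle `x` of `L` (§27).
[cite: CasselsFrohlichANT1967, Ch. VII §11.3] -/
theorem exists_layerPairingValue_eq_classInvAll_baseCup (h : L ≤ E) {m : ℕ} (hm : 0 < m)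
    (φ : triv (k := ℤ) (Γ := (L.openNormalSubgroup : Subgroup (absoluteGaloisGroup F))) ℤ ⟶
      (resD ℤ (L.openNormalSubgroup : Subgroup (absoluteGaloisGroup F))).obj (classData F).toSystem.toD) :
    letI := GalLayer.algebraOfLE h; haveI := GalLayer.isScalarTower_of_le h; haveI := L.numberField;
    haveI := E.numberField; haveI := E.isGalois; haveI : IsGalois L.1 E.1 := IsGalois.tower_top_of_isGalois F L.1 E.1;
    haveI : NeZero m := ⟨hm.ne'⟩
    ∃ x : ideleGroup L.1, ∀ χ : groupCohomology (Rep.trivial ℤ ((L.openNormalSubgroup : Subgroup (absoluteGaloisGroup F)) ⧸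
        (traceOpenNormalSubgroup (L.openNormalSubgroup : Subgroup (absoluteGaloisGroup F)) E.openNormalSubgroup :
          Subgroup (L.openNormalSubgroup : Subgroup (absoluteGaloisGroup F)))) (ZMod m)) 1,
      classBarInvAt F (L.openNormalSubgroup : Subgroup (absoluteGaloisGroup F)) (LayerColimit.coe_isOpen _)
          (LayerColimit.inflG
            (traceOpenNormalSubgroup (L.openNormalSubgroup : Subgroup (absoluteGaloisGroup F)) E.openNormalSubgroup)
            ((resD ℤ (L.openNormalSubgroup : Subgroup (absoluteGaloisGroup F))).obj (classData F).toSystem.toD) 2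
            (groupCohomology.map (MonoidHom.id _)
              (LayerColimit.homToLayer
                (traceOpenNormalSubgroup (L.openNormalSubgroup : Subgroup (absoluteGaloisGroup F)) E.openNormalSubgroup :
                  Subgroup (L.openNormalSubgroup : Subgroup (absoluteGaloisGroup F)))
                ((resD ℤ (L.openNormalSubgroup : Subgroup (absoluteGaloisGroup F))).obj (classData F).toSystem.toD) φ) 2
              (groupCohomology.δ (Bockstein.intModShortComplex_shortExact
                ((L.openNormalSubgroup : Subgroup (absoluteGaloisGroup F)) ⧸
                  (traceOpenNormalSubgroup (L.openNormalSubgroup : Subgroup (absoluteGaloisGroup F)) E.openNormalSubgroup :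
                    Subgroup (L.openNormalSubgroup : Subgroup (absoluteGaloisGroup F)))) m) 1 2 rfl χ))) =
        IdeleCohomology.classInvAll L.1 E.1
          (IdeleCohomology.baseCup (E := E.1) x
            (groupCohomology.δ (Bockstein.intModShortComplex_shortExact (E.1 ≃ₐ[L.1] E.1) m) 1 2 rfl
              ((H1IsoOfIsTrivial (Rep.trivial ℤ (E.1 ≃ₐ[L.1] E.1) (ZMod m))).inv (galCharacter h χ)))) := by
  obtain ⟨x, hx⟩ := exists_coe_baseInvariant_eq_layerVector h φ
  exact ⟨x, fun χ => layerPairingValue_eq_classInvAll_baseCup h hm φ χ x hx⟩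

end IdeleClassBar

end Literature.NumberTheory.GaloisRepresentations

end
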